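import Summits.AtomisticToContinuum.HydrodynamicLimit.Theorems.CollisionIsometryCLTAdaptedWeightCLTBHEEPClosureBounds

/-!
# Stub `stub_eepClosure` (S5) of the line `block-h-dissipation-closure`, helper file 8: the cell's traceless stress
and heat flux against the `L¹` distance of the regularised law to its floor (truncation + uniform integrability)
(crux `CollisionIsometryCLT.AdaptedWeightCLT`, stmt-AtomisticToContinuum-14868; `--supports`)

Step (iii), second half, and step (iv) of the planner's sketch of `stub_eepClosure`, for a probability cloud with
`Σ p_i (1 + |v_i|²)³ ≤ R`, `0 < h ≤ 1`, `0 < δ < 1`, regularised law `f̂`, floor `M`, mean `ū`: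
* by the EXACT identities (helper file 2) and the vanishing floor moments (helper file 1),
  `cloudP2 = (1−δ)⁻¹ ∫ (f̂ − M) p₂`, `cloudP3 = (1−δ)⁻¹ ∫ (f̂ − M) p₃` (`cloudP2_eq_integral_sub`, `cloudP3_eq_integral_sub`);
* TRUNCATION at radius `ℓ` about `ū` (`abs_integral_sub_mul_p2Poly_le`, `…p3Poly_le`):
  `|∫ (f̂ − M) p₂| ≤ (4/3)(ℓ² ∫|f̂ − M| + m₄/ℓ²)`, `|∫ (f̂ − M) p₃| ≤ ½ (ℓ³ ∫|f̂ − M| + m₆/ℓ³)`, with the centred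
  moments `m_k = ∫ (f̂ + M)|w − ū|^k`, `k = 4, 6`, both at most `16 (1+R)³ C(R)` UNIFORMLY (`exists_centredMoment_le`,
  from the sixth-moment bound of helper file 6) — this is the uniform integrability that lets `∫|f̂ − M| → 0`
  force the cell's traceless stress and heat flux to `0`;
* hence (`exists_cloudDefect_le_of_L1`): for every `ε > 0` there is `s₀ = s₀(h, δ, R, ε) > 0` with
  `∫ |f̂ − M| ≤ s₀ ⇒ cloudDefect ≤ ε`.
No definitions. Registered anchor: `bhEEPClosure_cellPrep_anchor` (the truncation inequality `x ≤ ℓ² + x²/ℓ²`).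
-/

namespace Summit.AtomisticToContinuum.HydrodynamicLimit.Theorems.BlockHDissipation

open scoped BigOperators Topology Classical MeasureTheory ENNReal InnerProductSpace
open Filter Set MeasureTheory Real
open Literature.Analysis.FluidPDE
open Summit.AtomisticToContinuum.HydrodynamicLimit.Theorems.ContactSourceDuhamel (T3 V3 Cfg Vel Flow Flows)
open Literature.MathematicalPhysics.KineticTheory (localMaxwellian_pos localMaxwellian_nonneg continuous_localMaxwellian
  integral_localMaxwellian_one integrable_localMaxwellian)

noncomputable section

namespace EEP

variable {n : ℕ} {p : Fin n → ℝ} {v : Fin n → V3} {h δ : ℝ}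

/-! ## The moments as integrals against `f̂ − M` -/

/-- `cloudP2 = (1−δ)⁻¹ ∫ (f̂ − M) p₂`. -/
theorem cloudP2_eq_integral_sub (hp : ∀ i, 0 ≤ p i) (hh : 0 < h) (hδ1 : δ < 1) (j k : Fin 3) :
    cloudP2 p v j k = (1 - δ)⁻¹ *
      ∫ w, (cloudLaw h δ p v w - cloudMaxw h p v w) * p2Poly (cloudMean p v) j k w := by
  have h1 := integral_cloudLaw_mul_p2Poly (p := p) hp hh δ v j k
  have h2 : ∫ w, cloudMaxw h p v w * p2Poly (cloudMean p v) j k w = 0 :=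
    integral_localMaxwellian_mul_p2Poly (cloudTemp_add_sq_pos hp v hh) _ j k
  have hI1 : Integrable fun w => cloudLaw h δ p v w * p2Poly (cloudMean p v) j k w :=
    integrable_cloudLaw_mul_of_le hp hh δ (continuous_p2Poly _ j k) (abs_p2Poly_le _ j k)
  have hI2 : Integrable fun w => cloudMaxw h p v w * p2Poly (cloudMean p v) j k w :=
    integrable_cloudMaxw_mul hp hh (continuous_p2Poly _ j k) (abs_p2Poly_le _ j k)
  simp_rw [sub_mul]
  rw [integral_sub hI1 hI2, h1, h2, sub_zero, ← mul_assoc, inv_mul_cancel₀ (by linarith), one_mul]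

/-- `cloudP3 = (1−δ)⁻¹ ∫ (f̂ − M) p₃` (probability cloud). -/
theorem cloudP3_eq_integral_sub (hp : ∀ i, 0 ≤ p i) (hp1 : ∑ i, p i = 1) (hh : 0 < h) (hδ1 : δ < 1) (a : Fin 3) :
    cloudP3 p v a = (1 - δ)⁻¹ *
      ∫ w, (cloudLaw h δ p v w - cloudMaxw h p v w) * p3Poly (cloudMean p v) a w := by
  have h1 := integral_cloudLaw_mul_p3Poly (p := p) hp hp1 hh δ v a
  have h2 : ∫ w, cloudMaxw h p v w * p3Poly (cloudMean p v) a w = 0 :=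
    integral_localMaxwellian_mul_p3Poly (cloudTemp_add_sq_pos hp v hh) _ a
  have hI1 : Integrable fun w => cloudLaw h δ p v w * p3Poly (cloudMean p v) a w :=
    integrable_cloudLaw_mul_of_le hp hh δ (continuous_p3Poly _ a) (abs_p3Poly_le _ a)
  have hI2 : Integrable fun w => cloudMaxw h p v w * p3Poly (cloudMean p v) a w :=
    integrable_cloudMaxw_mul hp hh (continuous_p3Poly _ a) (abs_p3Poly_le _ a)
  simp_rw [sub_mul]
  rw [integral_sub hI1 hI2, h1, h2, sub_zero, ← mul_assoc, inv_mul_cancel₀ (by linarith), one_mul]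

/-! ## Truncation -/

/-- The truncation inequality: `x ≤ ℓ² + x²/ℓ²` for `ℓ > 0` (indeed `2x ≤ ℓ² + x²/ℓ²`). -/
theorem le_sq_add_sq_div (x : ℝ) {ℓ : ℝ} (hℓ : 0 < ℓ) : x ≤ ℓ ^ 2 + x ^ 2 / ℓ ^ 2 := by
  have hℓ2 : 0 < ℓ ^ 2 := pow_pos hℓ 2
  rw [add_div' _ _ _ hℓ2.ne', le_div_iff₀ hℓ2]
  nlinarith [sq_nonneg (x - ℓ ^ 2)]

/-- Integrability of `g |w − ū|^k`-type products for `g ∈ {f̂, M}`: with the weight `(1+|w|²)³`. -/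
theorem norm_sub_pow_four_le (u w : V3) : ‖w - u‖ ^ 4 ≤ 8 * (1 + ‖u‖ ^ 2) ^ 3 * (1 + ‖w‖ ^ 2) ^ 3 := by
  have hQ : ‖w - u‖ ^ 2 ≤ 2 * ((1 + ‖u‖ ^ 2) * (1 + ‖w‖ ^ 2)) := by
    nlinarith [norm_sub_le w u, norm_nonneg (w - u), norm_nonneg w, norm_nonneg u, sq_nonneg (‖w‖ - ‖u‖),
      mul_nonneg (sq_nonneg ‖u‖) (sq_nonneg ‖w‖)]
  have hQ1 : 1 ≤ (1 + ‖u‖ ^ 2) * (1 + ‖w‖ ^ 2) := by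
    nlinarith [sq_nonneg ‖u‖, sq_nonneg ‖w‖, mul_nonneg (sq_nonneg ‖u‖) (sq_nonneg ‖w‖)]
  calc ‖w - u‖ ^ 4 = (‖w - u‖ ^ 2) ^ 2 := by ring
    _ ≤ (2 * ((1 + ‖u‖ ^ 2) * (1 + ‖w‖ ^ 2))) ^ 2 := pow_le_pow_left₀ (sq_nonneg _) hQ 2
    _ = 4 * ((1 + ‖u‖ ^ 2) * (1 + ‖w‖ ^ 2)) ^ 2 := by ring
    _ ≤ 8 * ((1 + ‖u‖ ^ 2) * (1 + ‖w‖ ^ 2)) ^ 3 := by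
        nlinarith [pow_le_pow_right₀ hQ1 (by norm_num : 2 ≤ 3), pow_nonneg (zero_le_one.trans hQ1) 3]
    _ = 8 * (1 + ‖u‖ ^ 2) ^ 3 * (1 + ‖w‖ ^ 2) ^ 3 := by ring

/-- `|w − ū|⁶ ≤ 8 (1+|ū|²)³ (1+|w|²)³`. -/
theorem norm_sub_pow_six_le (u w : V3) : ‖w - u‖ ^ 6 ≤ 8 * (1 + ‖u‖ ^ 2) ^ 3 * (1 + ‖w‖ ^ 2) ^ 3 := by
  have hQ : ‖w - u‖ ^ 2 ≤ 2 * ((1 + ‖u‖ ^ 2) * (1 + ‖w‖ ^ 2)) := by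
    nlinarith [norm_sub_le w u, norm_nonneg (w - u), norm_nonneg w, norm_nonneg u, sq_nonneg (‖w‖ - ‖u‖),
      mul_nonneg (sq_nonneg ‖u‖) (sq_nonneg ‖w‖)]
  calc ‖w - u‖ ^ 6 = (‖w - u‖ ^ 2) ^ 3 := by ring
    _ ≤ (2 * ((1 + ‖u‖ ^ 2) * (1 + ‖w‖ ^ 2))) ^ 3 := pow_le_pow_left₀ (sq_nonneg _) hQ 3
    _ = 8 * (1 + ‖u‖ ^ 2) ^ 3 * (1 + ‖w‖ ^ 2) ^ 3 := by ring

/-- **UNIFORM CENTRED MOMENTS (uniform integrability of the cells)**: there is `Mb = Mb(R) ≥ 0` such that for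
`0 < h ≤ 1`, `0 ≤ δ ≤ 1` and every probability cloud with `Σ p_i (1 + |v_i|²)³ ≤ R`, the centred fourth and sixth
moments of `f̂ + M` are at most `Mb`, and the relevant products are integrable. -/
theorem exists_centredMoment_le (R : ℝ) :
    ∃ Mb : ℝ, 0 ≤ Mb ∧ ∀ (h δ : ℝ), 0 < h → h ≤ 1 → 0 ≤ δ → δ ≤ 1 →
      ∀ (n : ℕ) (p : Fin n → ℝ) (v : Fin n → V3), (∀ i, 0 ≤ p i) → ∑ i, p i = 1 →
        ∑ i, p i * (1 + ‖v i‖ ^ 2) ^ 3 ≤ R →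
          (∫ w, (cloudLaw h δ p v w + cloudMaxw h p v w) * ‖w - cloudMean p v‖ ^ 4 ≤ Mb) ∧
          (∫ w, (cloudLaw h δ p v w + cloudMaxw h p v w) * ‖w - cloudMean p v‖ ^ 6 ≤ Mb) := by
  obtain ⟨C, hC0, hC⟩ := exists_integral_cloudLaw_mul_cube_le R
  refine ⟨16 * (1 + |R|) ^ 3 * C, by positivity, fun h δ hh hh1 hδ hδ1 n p v hp hp1 hR => ?_⟩
  obtain ⟨hfC, hMC⟩ := hC h δ hh hh1 hδ hδ1 n p v hp hp1 hR
  have hu : ‖cloudMean p v‖ ^ 2 ≤ |R| := (norm_cloudMean_sq_le hp hp1 hR).trans (le_abs_self R)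
  have hu3 : (1 + ‖cloudMean p v‖ ^ 2) ^ 3 ≤ (1 + |R|) ^ 3 := pow_le_pow_left₀ (by positivity) (by linarith) 3
  have hf0 : ∀ w, 0 ≤ cloudLaw h δ p v w := fun w =>
    (mul_nonneg hδ (cloudMaxw_pos hp hh w).le).trans (delta_mul_cloudMaxw_le hp hh hδ1 w)
  have hM0 : ∀ w, 0 ≤ cloudMaxw h p v w := fun w => (cloudMaxw_pos hp hh w).le
  -- integrable majorant `(f̂ + M)(1+|w|²)³`
  have hIf := integrable_cloudLaw_mul_of_le (v := v) hp hh δ continuous_one_add_norm_sq_cube (C := 1) (k := 6)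
    (fun w => by rw [abs_of_nonneg (by positivity), one_mul]; exact one_add_norm_sq_cube_le w)
  have hIM := integrable_cloudMaxw_mul (v := v) hp hh continuous_one_add_norm_sq_cube (C := 1) (k := 6)
    (fun w => by rw [abs_of_nonneg (by positivity), one_mul]; exact one_add_norm_sq_cube_le w)
  have hdom : Integrable fun w => 8 * (1 + ‖cloudMean p v‖ ^ 2) ^ 3 *
      ((cloudLaw h δ p v w + cloudMaxw h p v w) * (1 + ‖w‖ ^ 2) ^ 3) :=
    ((hIf.fun_add hIM).congr (Eventually.of_forall fun w => by simp only; ring)).const_mul _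
  have hdomInt : ∫ w, 8 * (1 + ‖cloudMean p v‖ ^ 2) ^ 3 *
      ((cloudLaw h δ p v w + cloudMaxw h p v w) * (1 + ‖w‖ ^ 2) ^ 3) ≤ 16 * (1 + |R|) ^ 3 * C := by
    rw [integral_const_mul]
    have hsum : ∫ w, (cloudLaw h δ p v w + cloudMaxw h p v w) * (1 + ‖w‖ ^ 2) ^ 3 ≤ C + C := by
      have : (fun w => (cloudLaw h δ p v w + cloudMaxw h p v w) * (1 + ‖w‖ ^ 2) ^ 3) =
          fun w => cloudLaw h δ p v w * (1 + ‖w‖ ^ 2) ^ 3 + cloudMaxw h p v w * (1 + ‖w‖ ^ 2) ^ 3 := by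
        funext w; ring
      rw [this, integral_add hIf hIM]
      exact add_le_add hfC hMC
    have h0 : 0 ≤ ∫ w, (cloudLaw h δ p v w + cloudMaxw h p v w) * (1 + ‖w‖ ^ 2) ^ 3 :=
      integral_nonneg fun w => mul_nonneg (add_nonneg (hf0 w) (hM0 w)) (by positivity)
    nlinarith [hu3, hC0, mul_le_mul hu3 hsum h0 (by positivity)]
  constructor
  · refine le_trans (integral_mono_of_nonneg (Eventually.of_forall fun w => ?_) hdom
      (Eventually.of_forall fun w => ?_)) hdomInt
    · exact mul_nonneg (add_nonneg (hf0 w) (hM0 w)) (by positivity)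
    · have := norm_sub_pow_four_le (cloudMean p v) w
      have hg : 0 ≤ cloudLaw h δ p v w + cloudMaxw h p v w := add_nonneg (hf0 w) (hM0 w)
      nlinarith [mul_le_mul_of_nonneg_left this hg]
  · refine le_trans (integral_mono_of_nonneg (Eventually.of_forall fun w => ?_) hdom
      (Eventually.of_forall fun w => ?_)) hdomInt
    · exact mul_nonneg (add_nonneg (hf0 w) (hM0 w)) (by positivity)
    · have := norm_sub_pow_six_le (cloudMean p v) w
      have hg : 0 ≤ cloudLaw h δ p v w + cloudMaxw h p v w := add_nonneg (hf0 w) (hM0 w)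
      nlinarith [mul_le_mul_of_nonneg_left this hg]

/-- **TRUNCATION, stress channel**: for every `ℓ > 0`,
`|∫ (f̂ − M) p₂| ≤ (4/3) (ℓ² ∫ |f̂ − M| + (∫ (f̂ + M)|w − ū|⁴)/ℓ²)` (given the integrabilities). -/
theorem abs_integral_sub_mul_p2Poly_le {f M : V3 → ℝ} (u : V3) (hf0 : ∀ w, 0 ≤ f w) (hM0 : ∀ w, 0 ≤ M w)
    (hI1 : Integrable fun w => |f w - M w|) (hI4 : Integrable fun w => (f w + M w) * ‖w - u‖ ^ 4)
    {ℓ : ℝ} (hℓ : 0 < ℓ) (j k : Fin 3) :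
    |∫ w, (f w - M w) * p2Poly u j k w| ≤
      4 / 3 * ((ℓ ^ 2 * ∫ w, |f w - M w|) + (∫ w, (f w + M w) * ‖w - u‖ ^ 4) / ℓ ^ 2) := by
  have hpt : ∀ w, ‖(f w - M w) * p2Poly u j k w‖ ≤
      4 / 3 * (ℓ ^ 2 * |f w - M w| + (f w + M w) * ‖w - u‖ ^ 4 / ℓ ^ 2) := by
    intro w
    rw [Real.norm_eq_abs, abs_mul]
    have h1 := abs_p2Poly_le_norm_sq u w j k
    have h2 := le_sq_add_sq_div (‖w - u‖ ^ 2) hℓ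
    have hfm : |f w - M w| ≤ f w + M w := (abs_sub _ _).trans (by rw [abs_of_nonneg (hf0 w), abs_of_nonneg (hM0 w)])
    have h4 : (‖w - u‖ ^ 2) ^ 2 = ‖w - u‖ ^ 4 := by ring
    rw [h4] at h2
    calc |f w - M w| * |p2Poly u j k w| ≤ |f w - M w| * (4 / 3 * ‖w - u‖ ^ 2) :=
          mul_le_mul_of_nonneg_left h1 (abs_nonneg _)
      _ ≤ |f w - M w| * (4 / 3 * (ℓ ^ 2 + ‖w - u‖ ^ 4 / ℓ ^ 2)) :=
          mul_le_mul_of_nonneg_left (mul_le_mul_of_nonneg_left h2 (by norm_num)) (abs_nonneg _)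
      _ = 4 / 3 * (ℓ ^ 2 * |f w - M w| + |f w - M w| * ‖w - u‖ ^ 4 / ℓ ^ 2) := by ring
      _ ≤ 4 / 3 * (ℓ ^ 2 * |f w - M w| + (f w + M w) * ‖w - u‖ ^ 4 / ℓ ^ 2) := by
          have : |f w - M w| * ‖w - u‖ ^ 4 / ℓ ^ 2 ≤ (f w + M w) * ‖w - u‖ ^ 4 / ℓ ^ 2 :=
            div_le_div_of_nonneg_right (mul_le_mul_of_nonneg_right hfm (by positivity)) (by positivity)
          linarith
  have hg : Integrable fun w => 4 / 3 * (ℓ ^ 2 * |f w - M w| + (f w + M w) * ‖w - u‖ ^ 4 / ℓ ^ 2) :=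
    ((hI1.const_mul _).fun_add (hI4.div_const _)).const_mul _
  refine (Real.norm_eq_abs _ ▸ norm_integral_le_of_norm_le hg (Eventually.of_forall hpt)).trans (le_of_eq ?_)
  rw [integral_const_mul, integral_add (hI1.const_mul _) (hI4.div_const _), integral_const_mul, integral_div]

/-- **TRUNCATION, heat-flux channel**: for every `ℓ > 0`,
`|∫ (f̂ − M) p₃| ≤ ½ (ℓ³ ∫ |f̂ − M| + (∫ (f̂ + M)|w − ū|⁶)/ℓ³)`. -/
theorem abs_integral_sub_mul_p3Poly_le {f M : V3 → ℝ} (u : V3) (hf0 : ∀ w, 0 ≤ f w) (hM0 : ∀ w, 0 ≤ M w)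
    (hI1 : Integrable fun w => |f w - M w|) (hI6 : Integrable fun w => (f w + M w) * ‖w - u‖ ^ 6)
    {ℓ : ℝ} (hℓ : 0 < ℓ) (a : Fin 3) :
    |∫ w, (f w - M w) * p3Poly u a w| ≤
      1 / 2 * ((ℓ ^ 3 * ∫ w, |f w - M w|) + (∫ w, (f w + M w) * ‖w - u‖ ^ 6) / ℓ ^ 3) := by
  have hℓ3 : 0 < ℓ ^ 3 := pow_pos hℓ 3
  have hpt : ∀ w, ‖(f w - M w) * p3Poly u a w‖ ≤
      1 / 2 * (ℓ ^ 3 * |f w - M w| + (f w + M w) * ‖w - u‖ ^ 6 / ℓ ^ 3) := by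
    intro w
    rw [Real.norm_eq_abs, abs_mul]
    have h1 := abs_p3Poly_le_norm_cube u w a
    -- `y ≤ ℓ³ + y²/ℓ³` with `y = |w−u|³`
    have h2 : ‖w - u‖ ^ 3 ≤ ℓ ^ 3 + ‖w - u‖ ^ 6 / ℓ ^ 3 := by
      have := le_sq_add_sq_div (‖w - u‖ ^ 3) (Real.sqrt_pos.2 hℓ3)
      have hs : Real.sqrt (ℓ ^ 3) ^ 2 = ℓ ^ 3 := Real.sq_sqrt hℓ3.le
      rw [hs] at this
      calc ‖w - u‖ ^ 3 ≤ ℓ ^ 3 + (‖w - u‖ ^ 3) ^ 2 / ℓ ^ 3 := this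
        _ = ℓ ^ 3 + ‖w - u‖ ^ 6 / ℓ ^ 3 := by ring
    have hfm : |f w - M w| ≤ f w + M w := (abs_sub _ _).trans (by rw [abs_of_nonneg (hf0 w), abs_of_nonneg (hM0 w)])
    calc |f w - M w| * |p3Poly u a w| ≤ |f w - M w| * (1 / 2 * ‖w - u‖ ^ 3) :=
          mul_le_mul_of_nonneg_left h1 (abs_nonneg _)
      _ ≤ |f w - M w| * (1 / 2 * (ℓ ^ 3 + ‖w - u‖ ^ 6 / ℓ ^ 3)) :=
          mul_le_mul_of_nonneg_left (mul_le_mul_of_nonneg_left h2 (by norm_num)) (abs_nonneg _)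
      _ = 1 / 2 * (ℓ ^ 3 * |f w - M w| + |f w - M w| * ‖w - u‖ ^ 6 / ℓ ^ 3) := by ring
      _ ≤ 1 / 2 * (ℓ ^ 3 * |f w - M w| + (f w + M w) * ‖w - u‖ ^ 6 / ℓ ^ 3) := by
          have : |f w - M w| * ‖w - u‖ ^ 6 / ℓ ^ 3 ≤ (f w + M w) * ‖w - u‖ ^ 6 / ℓ ^ 3 :=
            div_le_div_of_nonneg_right (mul_le_mul_of_nonneg_right hfm (by positivity)) hℓ3.le
          linarith
  have hg : Integrable fun w => 1 / 2 * (ℓ ^ 3 * |f w - M w| + (f w + M w) * ‖w - u‖ ^ 6 / ℓ ^ 3) :=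
    ((hI1.const_mul _).fun_add (hI6.div_const _)).const_mul _
  refine (Real.norm_eq_abs _ ▸ norm_integral_le_of_norm_le hg (Eventually.of_forall hpt)).trans (le_of_eq ?_)
  rw [integral_const_mul, integral_add (hI1.const_mul _) (hI6.div_const _), integral_const_mul, integral_div]

/-! ## From the `L¹` distance to the cloud defect -/

/-- **CLOUD DEFECT FROM `L¹` DISTANCE.** For `0 < h ≤ 1`, `0 < δ < 1`, `R` and every `ε > 0` there is `s₀ > 0` such
that every probability cloud with `Σ p_i (1 + |v_i|²)³ ≤ R` and `∫ |f̂ − M| ≤ s₀` has `cloudDefect ≤ ε` (truncation at a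
radius `ℓ` chosen from the uniform centred moments, then the exact `(1−δ)` identities). -/
theorem exists_cloudDefect_le_of_L1 (hh : 0 < h) (hh1 : h ≤ 1) (hδ : 0 < δ) (hδ1 : δ < 1) (R : ℝ) {ε : ℝ}
    (hε : 0 < ε) :
    ∃ s₀ : ℝ, 0 < s₀ ∧ ∀ (n : ℕ) (p : Fin n → ℝ) (v : Fin n → V3), (∀ i, 0 ≤ p i) → ∑ i, p i = 1 →
      ∑ i, p i * (1 + ‖v i‖ ^ 2) ^ 3 ≤ R →
        ∫ w, |cloudLaw h δ p v w - cloudMaxw h p v w| ≤ s₀ → cloudDefect p v ≤ ε := by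
  obtain ⟨Mb, hMb0, hMb⟩ := exists_centredMoment_le R
  have h1δ : 0 < 1 - δ := by linarith
  -- `η` with `12 (1−δ)⁻² η² ≤ ε`, then `ℓ ≥ 1` with `Mb/ℓ ≤ η/3`, then `s₀ = η/(3ℓ³)`
  obtain ⟨η, hη0, hη1, hηε⟩ : ∃ η : ℝ, 0 < η ∧ η ≤ 1 ∧ η ≤ (1 - δ) ^ 2 * ε / 12 :=
    ⟨min 1 ((1 - δ) ^ 2 * ε / 12), lt_min one_pos (by positivity), min_le_left _ _, min_le_right _ _⟩
  obtain ⟨ℓ, hℓ1, hℓM⟩ : ∃ ℓ : ℝ, 1 ≤ ℓ ∧ 3 * Mb / η ≤ ℓ := ⟨max 1 (3 * Mb / η), le_max_left _ _, le_max_right _ _⟩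
  have hℓ0 : 0 < ℓ := lt_of_lt_of_le one_pos hℓ1
  have hMbℓ : Mb / ℓ ≤ η / 3 := by
    rw [div_le_iff₀ hℓ0]
    have : 3 * Mb ≤ ℓ * η := by rw [div_le_iff₀ hη0] at hℓM; linarith
    linarith
  have hℓ2 : ℓ ≤ ℓ ^ 2 := by nlinarith
  have hℓ3 : ℓ ≤ ℓ ^ 3 := by nlinarith
  have hMbℓ2 : Mb / ℓ ^ 2 ≤ η / 3 := (div_le_div_of_nonneg_left hMb0 hℓ0 hℓ2).trans hMbℓ
  have hMbℓ3 : Mb / ℓ ^ 3 ≤ η / 3 := (div_le_div_of_nonneg_left hMb0 hℓ0 hℓ3).trans hMbℓ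
  refine ⟨η / (3 * ℓ ^ 3), by positivity, fun n p v hp hp1 hR hL1 => ?_⟩
  have hf0 : ∀ w, 0 ≤ cloudLaw h δ p v w := fun w => (cloudLaw_pos hp hh hδ hδ1.le w).le
  have hM0 : ∀ w, 0 ≤ cloudMaxw h p v w := fun w => (cloudMaxw_pos hp hh w).le
  have hfi : Integrable (cloudLaw h δ p v) := integrable_cloudLaw hp hp1 hh δ
  have hMi : Integrable (cloudMaxw h p v) := integrable_localMaxwellian (cloudTemp_add_sq_pos hp v hh) _
  have hI1 : Integrable fun w => |cloudLaw h δ p v w - cloudMaxw h p v w| := (hfi.sub' hMi).abs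
  have hpoly : ∀ m : ℕ, Integrable fun w => (cloudLaw h δ p v w + cloudMaxw h p v w) * ‖w - cloudMean p v‖ ^ m := by
    intro m
    have hg : Continuous fun w : V3 => ‖w - cloudMean p v‖ ^ m := by fun_prop
    have hle : ∀ w : V3, |‖w - cloudMean p v‖ ^ m| ≤ (1 + ‖cloudMean p v‖) ^ m * (1 + ‖w‖) ^ m := fun w => by
      rw [abs_of_nonneg (by positivity), ← mul_pow]
      refine pow_le_pow_left₀ (norm_nonneg _) ?_ m
      nlinarith [norm_sub_le w (cloudMean p v), norm_nonneg w, norm_nonneg (cloudMean p v),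
        mul_nonneg (norm_nonneg (cloudMean p v)) (norm_nonneg w)]
    have := (integrable_cloudLaw_mul_of_le (v := v) hp hh δ hg hle).fun_add
      (integrable_cloudMaxw_mul (v := v) hp hh hg hle)
    exact this.congr (Eventually.of_forall fun w => by ring)
  obtain ⟨hm4, hm6⟩ := hMb h δ hh hh1 hδ.le hδ1.le n p v hp hp1 hR
  -- the two moment errors are `≤ η`
  have hℓ2s : ℓ ^ 2 * (η / (3 * ℓ ^ 3)) ≤ η / 3 := by
    rw [show ℓ ^ 2 * (η / (3 * ℓ ^ 3)) = η / 3 * (1 / ℓ) by field_simp]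
    exact mul_le_of_le_one_right (by positivity) (by rw [div_le_one hℓ0]; exact hℓ1)
  have hℓ3s : ℓ ^ 3 * (η / (3 * ℓ ^ 3)) = η / 3 := by field_simp
  have he2 : ∀ j k : Fin 3,
      |∫ w, (cloudLaw h δ p v w - cloudMaxw h p v w) * p2Poly (cloudMean p v) j k w| ≤ η := by
    intro j k
    refine (abs_integral_sub_mul_p2Poly_le (cloudMean p v) hf0 hM0 hI1 (hpoly 4) hℓ0 j k).trans ?_
    have h1 : ℓ ^ 2 * ∫ w, |cloudLaw h δ p v w - cloudMaxw h p v w| ≤ η / 3 :=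
      (mul_le_mul_of_nonneg_left hL1 (by positivity)).trans hℓ2s
    have h2 : (∫ w, (cloudLaw h δ p v w + cloudMaxw h p v w) * ‖w - cloudMean p v‖ ^ 4) / ℓ ^ 2 ≤ η / 3 :=
      (div_le_div_of_nonneg_right hm4 (by positivity)).trans hMbℓ2
    linarith
  have he3 : ∀ a : Fin 3, |∫ w, (cloudLaw h δ p v w - cloudMaxw h p v w) * p3Poly (cloudMean p v) a w| ≤ η := by
    intro a
    refine (abs_integral_sub_mul_p3Poly_le (cloudMean p v) hf0 hM0 hI1 (hpoly 6) hℓ0 a).trans ?_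
    have h1 : ℓ ^ 3 * ∫ w, |cloudLaw h δ p v w - cloudMaxw h p v w| ≤ η / 3 :=
      (mul_le_mul_of_nonneg_left hL1 (by positivity)).trans hℓ3s.le
    have h2 : (∫ w, (cloudLaw h δ p v w + cloudMaxw h p v w) * ‖w - cloudMean p v‖ ^ 6) / ℓ ^ 3 ≤ η / 3 :=
      (div_le_div_of_nonneg_right hm6 (by positivity)).trans hMbℓ3
    linarith
  -- the cloud's moments through the exact identities
  have hP2 : ∀ j k : Fin 3, cloudP2 p v j k ^ 2 ≤ ((1 - δ)⁻¹ * η) ^ 2 := by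
    intro j k
    rw [cloudP2_eq_integral_sub hp hh hδ1 j k, ← sq_abs, abs_mul, abs_of_pos (inv_pos.2 h1δ)]
    exact pow_le_pow_left₀ (by positivity) (mul_le_mul_of_nonneg_left (he2 j k) (inv_pos.2 h1δ).le) 2
  have hP3 : ∀ a : Fin 3, cloudP3 p v a ^ 2 ≤ ((1 - δ)⁻¹ * η) ^ 2 := by
    intro a
    rw [cloudP3_eq_integral_sub hp hp1 hh hδ1 a, ← sq_abs, abs_mul, abs_of_pos (inv_pos.2 h1δ)]
    exact pow_le_pow_left₀ (by positivity) (mul_le_mul_of_nonneg_left (he3 a) (inv_pos.2 h1δ).le) 2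
  have hsum : cloudDefect p v ≤ 12 * ((1 - δ)⁻¹ * η) ^ 2 := by
    unfold cloudDefect
    calc (∑ j : Fin 3, ∑ k : Fin 3, cloudP2 p v j k ^ 2) + ∑ a : Fin 3, cloudP3 p v a ^ 2
        ≤ (∑ _j : Fin 3, ∑ _k : Fin 3, ((1 - δ)⁻¹ * η) ^ 2) + ∑ _a : Fin 3, ((1 - δ)⁻¹ * η) ^ 2 :=
          add_le_add (Finset.sum_le_sum fun j _ => Finset.sum_le_sum fun k _ => hP2 j k)
            (Finset.sum_le_sum fun a _ => hP3 a)
      _ = 12 * ((1 - δ)⁻¹ * η) ^ 2 := by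
          simp only [Finset.sum_const, Finset.card_univ, Fintype.card_fin]; ring
  refine hsum.trans ?_
  -- `12 (1−δ)⁻² η² ≤ ε` from `η ≤ 1`, `η ≤ (1−δ)² ε / 12`
  have hd2 : 0 < (1 - δ) ^ 2 := by positivity
  have hkey : 12 * η ^ 2 ≤ (1 - δ) ^ 2 * ε := by nlinarith
  calc 12 * ((1 - δ)⁻¹ * η) ^ 2 = (12 * η ^ 2) * ((1 - δ) ^ 2)⁻¹ := by rw [mul_pow, inv_pow]; ring
    _ ≤ ((1 - δ) ^ 2 * ε) * ((1 - δ) ^ 2)⁻¹ := mul_le_mul_of_nonneg_right hkey (inv_nonneg.2 hd2.le)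
    _ = ε := by field_simp

end EEP

/-- Registered anchor of this helper file: the truncation inequality `x ≤ ℓ² + x²/ℓ²` for `x ≥ 0 < ℓ`
(`EEP.le_sq_add_sq_div`). -/
theorem bhEEPClosure_cellPrep_anchor : ∀ (x ℓ : ℝ), 0 < ℓ → x ≤ ℓ ^ 2 + x ^ 2 / ℓ ^ 2 :=
  fun x _ hℓ => EEP.le_sq_add_sq_div x hℓ

end

end Summit.AtomisticToContinuum.HydrodynamicLimit.Theorems.BlockHDissipation
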